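import Summits.BirchSwinnertonDyer.BirchSwinnertonDyer.Theorems.SchneiderFreeAdditiveX3AnticycControlAdditiveKFF
import Literature.NumberTheory.EllipticCurves.AnticyclotomicLocalNormResidueSymbolProofs
import HarnessLib

/-!
# The served control crux r4 `AnticycControlAdditiveKF` (stmt-BirchSwinnertonDyer-19548) CLOSED by
# name (route `SchneiderFreeAdditiveX3`, seat `bsd-schneider-door-c4` gen 6)

`AnticycControlAdditiveKF` (the K1 door's CONTROL corner, F2-class re-typing #2 of 18969
`AdditiveAnticycControl` → 19178 → 19295 → 19548): the pointwise anticyclotomic control input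
`SchneiderFree.AdditiveControlInputManinAt W p` — the control EQUALITY `#Sel = #(Λ/f_ac^Σ)_Γ · (torsion
atoms)` at an additive prime split in `K` — on every `W` in B6 ∩ X3 ∩ sst-twist with `r_an = 1`, `p`
odd, under the cite-only Poitou–Tate ×2 / Brink ×2 facts and Kolyvagin's theorem as EXPLICIT
antecedents (its own signature).  The F-record `AnticycControlAdditiveKFF` (item 19669, door-c6 g3
`anticycControlAdditiveKFF_proof`, p460070: regimes A / B1 / B2 closed p437517 / p437649 / p443572,
Fin_v by the canonical line with its character, composition p442095) is this statement under the ONE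
further cite-only LCFT antecedent `ZpExtension.exists_isFrobPow_mem_kerSubgroup_of_isAnticyclotomic`,
now a tree THEOREM (`…_holds`, `AnticyclotomicLocalNormResidueSymbolProofs`); so the item closes by
name.  The corner is the exact-count record, off the leaf's critical path since p447721/p448348 (the
leaf consumes only the inequality); closing it does not advance BSD beyond the typed reduction.
Proof only; no definition, no named fact, no `sorry`.
-/

namespace Summit.BirchSwinnertonDyer.BirchSwinnertonDyer.Theorems.SchneiderFreeAdditiveX3

set_option linter.dupNamespace false

/-- **Item stmt-BirchSwinnertonDyer-19548 `AnticycControlAdditiveKF` (served control crux r4),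
proved**: `anticycControlAdditiveKFF_proof` (F-record 19669) applied to the tree theorem
`ZpExtension.exists_isFrobPow_mem_kerSubgroup_of_isAnticyclotomic_holds`.
[cite: JetchevSkinnerWan2017, §3.3 Prop. 3.3.1, Thm. 3.3.3 (arXiv:1512.06894)]
[cite: GreenbergLNM1716, §3 Lemma 3.3] [cite: CasselsFrohlichANT1967, Ch. VII §6 Prop. 6.2] -/
theorem anticycControlAdditiveKF_proof :
    Summit.BirchSwinnertonDyer.BirchSwinnertonDyer.Theses.SchneiderFreeAdditiveX3.AnticycControlAdditiveKF :=
  anticycControlAdditiveKFF_proof fun K _ _ p _ =>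
    Literature.NumberTheory.EllipticCurves.ZpExtension.exists_isFrobPow_mem_kerSubgroup_of_isAnticyclotomic_holds K p

end Summit.BirchSwinnertonDyer.BirchSwinnertonDyer.Theorems.SchneiderFreeAdditiveX3
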